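import Summits.QuantumFields.BalabanUV.Beta.EriceRemainderEnclosureHistoryAutonomyComparisonAgeCompositionOldBlockSeparatedAges
import Summits.QuantumFields.BalabanUV.Beta.EriceRemainderEnclosureHistoryAutonomyComparisonAgeCompositionOldBlockCapSpan3

/-!
# EriceRemainderEnclosureHistoryAutonomyComparisonAgeCompositionOldBlockSpan3Levels — (E100h) route (N), first order: SPAN-3 BLOCKS AS LEVELS OF THE ×76 ∕
# ×75 CHAINS.  (E100g) `old_block_load_le_span3` caps any finite set of ages inside `[lo, 3lo]` (`56 ≤ lo`) at `13∕20`; (E100c)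
# `flow_nonneg_old_block_levels_of_cap` takes the block cap as a hypothesis.  Closure at `κ = 1∕5`: `0.2 + 3.12 = 3.32 ≤ R₀·0.22·0.2` iff `R₀ ≥ 75.5`:
# **`flow_nonneg_census_young_pair_span3_blocks`** (the census young pair `{1,k₂}`, `2 ≤ k₂ ≤ 29`, below a ×76 chain of span-3 blocks),
# **`flow_nonneg_young_age_span3_blocks`** (any young age, `κ = 1∕4`, ×75: `3.5 ≤ 3.515625`).  Coverage classes (2, ×64 ∕ ×62), (3, ×76 ∕ ×75), (4, ×100) are
# incomparable.

Cell `pub-balaban`, β-function sub-cell, BINDER row D4 «RemainderConst leaves for Bałaban's split» (`HOME/BINDER-OWNERS.md`; owner lineage `b2b-balaban-beta-an4`;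
this file by co-owner #2 lineage `b2b-balaban-beta-d4-p2`, generation 88), β-FLOW TEAM duty (1), FREEZE (0) honoured (def-free; nothing restated).

HONEST FRAMING (page 1, verbatim and binding).  *"Discharging BetaPertH makes Bałaban's UV stability UNCONDITIONAL — a real constructive-QFT result; it is
NOT the continuum limit and NOT the Clay problem."*  THIS FILE DISCHARGES NOTHING OF THE KIND.  Elementary real algebra ∕ real analysis about ABSTRACT
functionals on a box ]0,γ]^ℕ with displayed floors, profiles and signs, and the FIRST-ORDER renewal objects of route (N) built from them — hypotheses of a
census, not facts; the form, signs, ages and moments of Bałaban's (1.22) limit functional are NOT PRINTED ([I] p. 298; GAPS G-t4-U2-1∕-2) and NOT asserted.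
Row D4 class UNCHANGED (critical-path width 0; instance 0∕1; D4 DISCHARGE NO DATE).  HONEST DEPENDENCY: continuum YM on T⁴ ⇐ BetaPertH ∧ nine spine
estimates (0/9 proved); BetaPertH ⇐ (D1) ∧ (D4) ∧ CAP+tail; G-an2-4 gates asym, D1 and NE2/3/4.

THE POINT (README `HOME/b2b-balaban-beta-d4-p2/g88/README.md` §2(d)).  Uses (E100c) `flow_nonneg_old_block_levels_of_cap`, (E100g) `old_block_load_le_span3`,
(E97c) `young_pair_load_le`, (E94b) `load_le_of_sq` BY NAME.  NOT CLAIMED: anything printed — NOT B12 Thm 2, NOT BetaPertH, NOT continuum, NOT Clay.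

WHAT IS PROVED ([folklore]; 0 `def`, 0 sorry).  **`flow_nonneg_census_young_pair_span3_blocks`**, **`flow_nonneg_young_age_span3_blocks`**.
-/
noncomputable section
open Finset

namespace Summit.QuantumFields.BalabanUV.Beta.EriceRemainderEnclosureHistoryAutonomyComparisonAgeCompositionOldBlockSpan3Levels

open Literature.MathematicalPhysics.QuantumFieldTheory.Balaban1983to89
open Literature.MathematicalPhysics.QuantumFieldTheory.Balaban1983to89.T4BetaStationary
open Literature.MathematicalPhysics.QuantumFieldTheory.Balaban1983to89.T4BetaFlowWellPosed
open Summit.QuantumFields.BalabanUV.Beta.EriceRemainderEnclosureHistoryAutonomyComparisonAgeCompositionYoungPairMoment (load_le_of_sq)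
open Summit.QuantumFields.BalabanUV.Beta.EriceRemainderEnclosureHistoryAutonomyComparisonAgeCompositionOldBlockCapSpan3 (old_block_load_le_span3)
open Summit.QuantumFields.BalabanUV.Beta.EriceRemainderEnclosureHistoryAutonomyComparisonAgeCompositionOldBlockSeparatedAges
  (flow_nonneg_old_block_levels_of_cap)
open Summit.QuantumFields.BalabanUV.Beta.EriceRemainderEnclosureHistoryAutonomyComparisonAgeCompositionYoungPairCapSeparatedAges (young_pair_load_le)

variable {B : (ℕ → ℝ) → ℝ} {γ b gIR : ℝ} {L : ℕ → ℝ} {K : ℕ} {h g : ℕ → ℝ}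

/-- **THE CENSUS YOUNG PAIR `{1, k₂}`, `2 ≤ k₂ ≤ 29`, BELOW A ×76 CHAIN OF SPAN-3 BLOCKS, ANY NUMBER OF LEVELS.**  Profile carried by
`{1, k₂} ∪ ⋃_{1≤j<r} T j` with `T j ⊂ [a j, p j]` finite and arbitrary, `a j ≤ p j ≤ 3·a j`, `76k₂ ≤ a 1`, `76·p j ≤ a (j+1)`: `0 ≤ ε ≤ e` at every pin
((E100c) `flow_nonneg_old_block_levels_of_cap` with `κ = 1∕5`, caps `0.8333` (E97c) and `13∕20`, `R₀ = 76`: `3.32 ≤ 3.344`). [folklore] -/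
theorem flow_nonneg_census_young_pair_span3_blocks
    (hmono : ∀ u v : ℕ → ℝ, SeqBox γ u → SeqBox γ v → (∀ j, u j ≤ v j) → B u ≤ B v)
    (hL : ∀ k, 0 ≤ L k) (hb : 0 < b) (hlo : ∀ u, SeqBox γ u → b ≤ B u) (hdom : ∀ u, SeqBox γ u → ∑ k ∈ range K, L k * u k ≤ B u)
    (hh : SeqBox γ h) (hf : MemFlow B gIR h) (hg : ∀ t, 0 < g t ∧ g t ≤ 1)
    (hgF : ∀ t, 1 ≤ g t * (1 + ∑ k ∈ range K, L k * h (t + k) ^ 3 / 2))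
    {k₂ : ℕ} (hk2 : 2 ≤ k₂) (hk29 : k₂ ≤ 29) (hk2K : k₂ < K)
    {r : ℕ} {T : ℕ → Finset ℕ} {a p : ℕ → ℕ} (hr : 1 ≤ r) (hap : ∀ j, 1 ≤ j → j < r → a j ≤ p j ∧ p j ≤ 3 * a j)
    (hpK : ∀ j, 1 ≤ j → j < r → p j < K) (hT : ∀ j, 1 ≤ j → j < r → ∀ k ∈ T j, a j ≤ k ∧ k ≤ p j)
    (hsep0 : 1 < r → 76 * k₂ ≤ a 1) (hsep : ∀ j, 1 ≤ j → j + 1 < r → 76 * p j ≤ a (j + 1))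
    (hLa : ∀ l, l < K → l ≠ 1 → l ≠ k₂ → (∀ j, 1 ≤ j → j < r → l ∉ T j) → L l = 0)
    {N : ℕ} {KL : ℕ → ℕ → ℕ → ℝ}
    (hKL : ∀ k n l, KL k n l = if 0 < k ∧ k < K ∧ l < k then L k * h (n + k) ^ 3 / 2 * ∏ t ∈ Ico (n + 1 + l) (n + k + 1), g t else 0)
    {KA : ℕ → ℕ → ℕ → ℝ} {RA : ℕ → (ℕ → ℝ) → ℕ → ℝ}
    (hRA : ∀ i v m, RA i v m = ∑ l ∈ range K, KA i m l * v (m + 1 + l))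
    (hKA : ∀ i m l, KA i m l = KL i m l + KA (i + 1) m l) (hKAtop : ∀ m l, KA K m l = 0)
    {e ε : ℕ → ℝ} (he0 : ∀ m, 0 ≤ e m) (hea : ∀ m, e (m + 1) ≤ e m)
    (hεt : ∀ m, N < m → ε m = 0) (hεrec : ∀ m, ε m = e m - RA 1 ε m) : ∀ m, 0 ≤ ε m ∧ ε m ≤ e m := by
  refine flow_nonneg_old_block_levels_of_cap hmono hL hb hlo hdom hh hf hg hgF (by omega) (κ := 1 / 5) (s₀ := 8333 / 10000) (s := 13 / 20)
    (R₀ := 76) (Fm := 3) (by norm_num) (by norm_num) (by norm_num) (by norm_num) (by norm_num) (by norm_num)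
    (fun S lo hi q h1 h2 h3 h4 => old_block_load_le_span3 hmono hL hb hlo hdom hh hf h1 h2 h3 h4 q) (S₀ := {1, k₂}) (hi₀ := k₂)
    (fun k hk => ?_) (fun k hk => ?_) (by omega) (fun q => ?_) hr hap hpK hT hsep0 hsep (fun l hl hl0 hno => ?_) hKL hRA hKA hKAtop he0 hea hεt hεrec
  · simp only [mem_insert, mem_singleton] at hk; rcases hk with rfl | rfl <;> omega
  · simp only [mem_insert, mem_singleton] at hk; rcases hk with rfl | rfl <;> omega
  · rw [sum_pair (show (1 : ℕ) ≠ k₂ by omega), Nat.cast_one, one_mul]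
    exact young_pair_load_le hmono hL hb hlo hdom hh hf hk2 hk29 hk2K q
  · refine hLa l hl (fun h1 => hl0 ?_) (fun h2 => hl0 ?_) hno
    · rw [h1]; exact mem_insert_self _ _
    · rw [h2]; exact mem_insert_of_mem (mem_singleton_self _)

/-- **ANY YOUNG AGE BELOW A ×75 CHAIN OF SPAN-3 BLOCKS, ANY NUMBER OF LEVELS.**  Profile carried by `{a₀} ∪ ⋃_{1≤j<r} T j` with `a₀ ≥ 1` ARBITRARY,
`T j ⊂ [a j, p j]` finite and arbitrary, `a j ≤ p j ≤ 3·a j`, `75a₀ ≤ a 1`, `75·p j ≤ a (j+1)`: `0 ≤ ε ≤ e` at every pin (`κ = 1∕4`, caps `0.7072` (E94b) and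
`13∕20`, `R₀ = 75`: `3.5 ≤ 3.515625`). [folklore] -/
theorem flow_nonneg_young_age_span3_blocks
    (hmono : ∀ u v : ℕ → ℝ, SeqBox γ u → SeqBox γ v → (∀ j, u j ≤ v j) → B u ≤ B v)
    (hL : ∀ k, 0 ≤ L k) (hb : 0 < b) (hlo : ∀ u, SeqBox γ u → b ≤ B u) (hdom : ∀ u, SeqBox γ u → ∑ k ∈ range K, L k * u k ≤ B u)
    (hh : SeqBox γ h) (hf : MemFlow B gIR h) (hg : ∀ t, 0 < g t ∧ g t ≤ 1)
    (hgF : ∀ t, 1 ≤ g t * (1 + ∑ k ∈ range K, L k * h (t + k) ^ 3 / 2))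
    {a₀ : ℕ} (ha0 : 1 ≤ a₀) (ha0K : a₀ < K)
    {r : ℕ} {T : ℕ → Finset ℕ} {a p : ℕ → ℕ} (hr : 1 ≤ r) (hap : ∀ j, 1 ≤ j → j < r → a j ≤ p j ∧ p j ≤ 3 * a j)
    (hpK : ∀ j, 1 ≤ j → j < r → p j < K) (hT : ∀ j, 1 ≤ j → j < r → ∀ k ∈ T j, a j ≤ k ∧ k ≤ p j)
    (hsep0 : 1 < r → 75 * a₀ ≤ a 1) (hsep : ∀ j, 1 ≤ j → j + 1 < r → 75 * p j ≤ a (j + 1))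
    (hLa : ∀ l, l < K → l ≠ a₀ → (∀ j, 1 ≤ j → j < r → l ∉ T j) → L l = 0)
    {N : ℕ} {KL : ℕ → ℕ → ℕ → ℝ}
    (hKL : ∀ k n l, KL k n l = if 0 < k ∧ k < K ∧ l < k then L k * h (n + k) ^ 3 / 2 * ∏ t ∈ Ico (n + 1 + l) (n + k + 1), g t else 0)
    {KA : ℕ → ℕ → ℕ → ℝ} {RA : ℕ → (ℕ → ℝ) → ℕ → ℝ}
    (hRA : ∀ i v m, RA i v m = ∑ l ∈ range K, KA i m l * v (m + 1 + l))
    (hKA : ∀ i m l, KA i m l = KL i m l + KA (i + 1) m l) (hKAtop : ∀ m l, KA K m l = 0)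
    {e ε : ℕ → ℝ} (he0 : ∀ m, 0 ≤ e m) (hea : ∀ m, e (m + 1) ≤ e m)
    (hεt : ∀ m, N < m → ε m = 0) (hεrec : ∀ m, ε m = e m - RA 1 ε m) : ∀ m, 0 ≤ ε m ∧ ε m ≤ e m := by
  refine flow_nonneg_old_block_levels_of_cap hmono hL hb hlo hdom hh hf hg hgF (by omega) (κ := 1 / 4) (s₀ := 7072 / 10000) (s := 13 / 20)
    (R₀ := 75) (Fm := 3) (by norm_num) (by norm_num) (by norm_num) (by norm_num) (by norm_num) (by norm_num)
    (fun S lo hi q h1 h2 h3 h4 => old_block_load_le_span3 hmono hL hb hlo hdom hh hf h1 h2 h3 h4 q) (S₀ := {a₀}) (hi₀ := a₀)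
    (fun k hk => ?_) (fun k hk => ?_) (by omega) (fun q => ?_) hr hap hpK hT hsep0 hsep (fun l hl hl0 hno => ?_) hKL hRA hKA hKAtop he0 hea hεt hεrec
  · rw [mem_singleton] at hk; subst hk; exact ⟨ha0, ha0K⟩
  · rw [mem_singleton] at hk; omega
  · rw [sum_singleton]
    have ha0r : (1 : ℝ) ≤ a₀ := by exact_mod_cast ha0
    exact load_le_of_sq hmono hL hb hlo hdom hh hf ha0 ha0K (so := 7072 / 10000) (by norm_num) (by nlinarith) q
  · exact hLa l hl (fun h1 => hl0 (by rw [h1]; exact mem_singleton_self _)) hno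

end Summit.QuantumFields.BalabanUV.Beta.EriceRemainderEnclosureHistoryAutonomyComparisonAgeCompositionOldBlockSpan3Levels
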